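import Literature.MathematicalPhysics.QuantumFieldTheory.Balaban1983to89.B8Ineq166Univ

/-!
# `Balaban1983to89.B8Ineq165AllLevels` — [Balaban1985RegularSpaces] p. 87 **(1.65)**: «the conditions (1.33)–(1.35) imply
# |(U′U₀)‾ʲ − Ū₀ʲ| = |Ũ′ʲ − 1| < 11d²α₀ + α₁ on Ω_j^{(j)}», AT EVERY LEVEL `j ≤ k`, for a region sequence with its tower
# decomposition (1.6), FROM THE GENUINE (1.35) («on Λ_j», the LAYERS, p. 77 bond convention)

statement-level skeleton of published theorems with citation tags; proofs where landed; nothing here is a claim about the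
Yang–Mills mass gap

PDF held: `paper:balaban1985-cmp99-regular-spaces-gauge-fixing` (journal page = PDF page + 74); p. 77 ((1.3)–(1.7) and the bond
convention «we denote by Ω also the set of bonds ⋃_{x∈Ω} st(x) = {bonds b: at least one end-point of b belongs to Ω}»), p. 79
((1.19)–(1.20)), p. 82 ((1.33)–(1.35)), p. 87 ((1.65)–(1.66)), p. 88 (Theorem 4, «Of course this theorem implies Theorem 2»).

WHY THIS FILE (cell `pub-ymgap`, seat `pub-ymgap-dag-n05-a` g6, KNIT seat of DAG node N05 = [B8]; count-neutral).  REPAIR OF RECORD of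
`B8Ineq166Univ.norm_pert_sub_one_le_univ` (p433133), located by the discharge referee (dag-ref-A g8, VERDICTS row g8-5, probe
`n05-ineq166univ-probe.g8.lean` P1 `probe_level0_suffices`): the hypothesis there called «(1.35) in the box form» — closeness of the
level-`j` averages on EVERY level-`j` bond whose two blocks lie in `Ω_j`, all `j ≤ k` — is print's **(1.66)** («on Ω_j^{(j)}», p. 87), NOT
print's **(1.35)** («on Λ_j», p. 82; `Λ_j` = the LAYER (1.5), a bond being «on Λ_j» when at least one end-point lies in `Λ_j`, p. 77), so
that theorem follows from its own hypothesis at `j = 0` and certifies nothing.  Here the hypothesis IS (1.35): closeness `≤ α₁` is assumed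
ONLY on the level-`j` bonds TOUCHING `Λ_j` (`B8Ineq132.BondTouches (Λs j)`, the p. 77 convention) — and, to be the weakest usable form,
only on those whose two-block box lies in `Ω_j` (automatic under print's (1.4); print's literal «on Λ_j» trivially implies this form) —
and the conclusion is (1.66) AT EVERY LEVEL `ℓ ≤ k`: `‖(U′U₀)‾ˡ(c) − Ū₀ˡ(c)‖ ≤ 8d²α₀(1 + L⁻² + … ) + α₁ < 11d²α₀ + α₁` on every
level-`ℓ` bond `c` whose two blocks sit in towers `Bʲ(y) ⊂ Ω_j`, `y ∈ Λ_j`, `Bʲ′(y′)`, `y′ ∈ Λ_j′` (`j, j′ ≥ ℓ`).  The proof is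
print's iterated Lemma 1 = lit-balaban's `B8Ineq165Local.ineq165_local` on the box of the two (equal or adjacent) level-`m` ancestors
`z, z′` of the bond's blocks at the common tower level `m = min j j′`, descending from `m` to `ℓ` (p433133 descended to `0` only):
its (1.7) inputs from `U₀, U′U₀ ∈ 𝔄_k` on `Ω_m ⊇` box, its (1.19) inputs from `Ax_k(𝔅_k, U₀)` along the two towers, and its top
input (1.35) at the ONE crossing bond `⟨z, z + e_ν⟩` of the box — which TOUCHES `Λ_m`, because the ancestor at the tower's own
level is the tower's top site: `z = y ∈ Λ_m` (`j = m`) or `z′ = y′ ∈ Λ_m` (`j′ = m`).  This is exactly why (1.35) on the LAYERS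
suffices, as print says.

WHAT IS PROVED (kernel, 0 sorry, theorems only): `inBox_bondBox_of_inBox_block_fst/snd` (the two blocks of a bond lie in its box);
**`norm_avg_sub_le_of135_sharp`** / **`norm_avg_sub_le_of135`** ((1.65) at level `ℓ` for a bond whose blocks sit in two towers, sharp /
`11d²α₀ + α₁` form); **`norm_avg_sub_le_allLevels_of135`** = (1.33)–(1.35) ⇒ (1.66) at every level `ℓ ≤ k` on every level-`ℓ` bond
whose box lies in `Ω_ℓ`, for a region sequence carrying the tower decomposition (1.6) AT EVERY LEVEL (`h16`: every level-`ℓ` block inside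
`Ω_ℓ` lies in a tower `Bʲ(y)`, `y ∈ Λ_j`, `j ≥ ℓ` — print's `Ω_j^{(j)} = ⋃_{i≥j} B^{i−j}(Λ_i)`); **`norm_pert_sub_one_le_univ_of135`** =
the level-`0` member `‖U′_b − 1‖ ≤ 11d²α₀ + α₁` on every bond of `ℤᵈ` for towers covering `ℤᵈ` (the statement p433133 meant, now
from the LAYER hypothesis; only the level-`0` partition (1.6)₀ is needed there).

HONEST SCOPE.  (1.65) itself (one tower of cubes) is lit-balaban's `ineq165_local` BY NAME; this file is its assembly over the tower
decomposition.  Windows as there (`C₀α₀ ≤ 1/3`, `2α₀ ≤ c₂′`, `11d²α₀ + α₁ ≤ 1/6`); `≤` for print's `<`; `T_η ↦ ℤᵈ`; the (1.66)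
currency of the conclusion is the tree's («box ⊂ Ω_j», both end-points' blocks in `Ω_j`; print's «on Ω_j^{(j)}» with the touching
convention is not claimed for bonds leaving `Ω_j`).  The all-levels law `h16` is a HYPOTHESIS on the region sequence (print's (1.6);
the N05 prototype index `B8LeafModelZd.ZdIdx` carries only its level-`0` instance `hpart` — a located design point for the NODE 00 pin,
not supplied here).  Count-neutral; N05 NOT discharged; nothing continuum / ℝ⁴ / OS / mass-gap / Clay.  Unit `pub-ymgap-dag-n05-a` (g6),
2026-08-26.
-/

noncomputable section

open scoped BigOperators

namespace Literature.MathematicalPhysics.QuantumFieldTheory.Balaban1983to89.B8Ineq165AllLevels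

open B7Prop1Explicit B7Prop2Explicit B7Prop1Local B8Lemma1NonAbelian B8Ineq130 B8Ineq165Descent
open B8Ineq132 (InAk Under BondTouches)
open B8Eq119TwistedAxial (InAx inAx_iff)
open B8Eq131Cubes (flm under_flm)
open B8Eq106Local (under_iff_tower)
open B8Eq131Derivation (under_zero_iff)
open B8Ineq166Univ (flm_under_of_under under_add_of_under under_or_of_box_pair flm_succ_coord pdevOn_box_lt_of_inAk)

-- `Site` alone would resolve to the torus sites of `Setup.lean`; re-export the `ℤ^d` sites of `B7Prop1Explicit`.
export B7Prop1Explicit (Site)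

variable {d : ℕ}

/-! ## §1 The two blocks of a level-`ℓ` bond lie in its box `[loK, bondHiK]` -/

/-- The block `Bˡ(w)` (finest coordinates `[tlo L w ℓ, thi L w ℓ]`) lies in the box `Bˡ(w) ∪ Bˡ(w + e_ν)` of the bond `⟨w, w + e_ν⟩`
(`[loK L ℓ w, bondHiK L ℓ w ν]`). [cite: Balaban1985Averaging, p.24 (the box `B(c₋) ∪ B(c₊)` of a bond)] -/
theorem inBox_bondBox_of_inBox_block_fst (L ℓ : ℕ) (w : Site d) (ν : Fin d) {x : Site d}
    (hx : InBox (tlo L w ℓ) (thi L w ℓ) x) : InBox (loK L ℓ w) (bondHiK L ℓ w ν) x := by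
  intro i
  obtain ⟨h1, h2⟩ := hx i
  rw [tlo_apply] at h1
  rw [thi_apply] at h2
  have hP : (0 : ℤ) ≤ (L : ℤ) ^ ℓ := by positivity
  simp only [loK, bondHiK]
  refine ⟨h1, ?_⟩
  split_ifs <;> linarith
/-- The block `Bˡ(w + e_ν)` lies in the box of the bond `⟨w, w + e_ν⟩`. [cite: Balaban1985Averaging, p.24 (the box `B(c₋) ∪ B(c₊)` of a bond)] -/
theorem inBox_bondBox_of_inBox_block_snd (L ℓ : ℕ) (w : Site d) (ν : Fin d) {x : Site d}
    (hx : InBox (tlo L (w + e ν) ℓ) (thi L (w + e ν) ℓ) x) : InBox (loK L ℓ w) (bondHiK L ℓ w ν) x := by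
  intro i
  obtain ⟨h1, h2⟩ := hx i
  rw [tlo_apply, add_e_apply] at h1
  rw [thi_apply, add_e_apply] at h2
  have hP : (0 : ℤ) ≤ (L : ℤ) ^ ℓ := by positivity
  simp only [loK, bondHiK]
  by_cases hi : i = ν
  · rw [if_pos hi] at h1 h2; rw [if_pos hi]; constructor <;> linarith
  · rw [if_neg hi] at h1 h2; rw [if_neg hi]; constructor <;> linarith

/-! ## §2 (1.65) at level `ℓ` for a bond whose two blocks sit in towers, from (1.35) ON THE LAYERS -/

section Towers

variable {𝔸 : Type*} [CStarAlgebra 𝔸] [Nontrivial 𝔸]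

/-- **(1.65) AT LEVEL `ℓ`, SHARP FORM, FROM (1.33)–(1.35)** (p. 87 «|Ũ′ʲ − 1| < 8d²α₀L^{−2(k−j−1)} + … + 8d²α₀ + α₁ < 11d²α₀ + α₁»):
for unitary-valued `U₀`, `U′` on `ℤᵈ` with (1.33) `U₀ ∈ 𝔄_k({Ω_j}, α₀)`, (1.34) `U′U₀ ∈ 𝔄_k({Ω_j}, α₀) ∩ Ax_k(𝔅_k, U₀)` (`InAk` +
`InAx L k Λs U₀ (U′U₀)`), **(1.35) on the layers**: `‖(U′U₀)‾ʲ(c) − Ū₀ʲ(c)‖ ≤ α₁` for every `j ≤ k` and every level-`j` bond `c` TOUCHING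
`Λ_j` (p. 77 convention, `BondTouches (Λs j)`) whose box lies in `Ω_j`, towers `Bʲ(y) ⊂ Ω_j` (`y ∈ Λs j`), `Ω` antitone, the windows
of (1.65); then for a level-`ℓ` bond `⟨w, w + e_ν⟩` whose blocks lie in towers — `Bˡ(w) ⊂ Bʲ(y)`, `y ∈ Λ_j`, and `Bˡ(w + e_ν) ⊂ Bʲ′(y′)`,
`y′ ∈ Λ_j′`, `ℓ ≤ j, j′ ≤ k` — `‖(U′U₀)‾ˡ − Ū₀ˡ‖ ≤ 8d²α₀ Σ_{i < min j j′ − ℓ} L^{−2i} + α₁ < 11d²α₀ + α₁` at that bond.  PROOF: at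
`m = min j j′` the level-`m` ancestors `z, z′` of the two blocks are equal or adjacent and lie in `Ω_m` with everything below them;
lit-balaban's `B8Ineq165Local.ineq165_local` on the box `[z, z′]`, descending `m − ℓ` levels; (1.7) inputs by `pdevOn_box_lt_of_inAk`,
(1.19) inputs from `InAx` along the two towers, top input (1.35) at the one crossing bond `⟨z, z + e_ν⟩`, which touches `Λ_m` since
`z = y` (`j = m`) or `z′ = y′` (`j′ = m`). [cite: Balaban1985RegularSpaces, (1.65)–(1.66) p.87, (1.33)–(1.35) p.82, (1.19)–(1.20) p.79, (1.5)–(1.7) p.77] -/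
theorem norm_avg_sub_le_of135_sharp (hd : 1 ≤ d) {L : ℕ} (hL : 2 ≤ L) (k : ℕ) {η : ℝ}
    {U₀ U' : Site d → Fin d → 𝔸ˣ} (hU₀ : ∀ x κ, U₀ x κ ∈ unitaryUnits 𝔸) (hU' : ∀ x κ, U' x κ ∈ unitaryUnits 𝔸)
    {α₀ α₁ : ℝ} (hα₀ : 0 < α₀) (hα3 : C0 d * α₀ ≤ 1 / 3) (hα2 : 2 * α₀ ≤ c2' d L) (hα₁ : 0 ≤ α₁)
    (hsmall : 11 * (d : ℝ) ^ 2 * α₀ + α₁ ≤ 1 / 6)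
    (Ω : ℕ → Set (Site d)) (hΩ : ∀ j, Ω (j + 1) ⊆ Ω j) (Λs : ℕ → Set (Site d))
    (htower : ∀ j, j ≤ k → ∀ y ∈ Λs j, ∀ x, InBox (tlo L y j) (thi L y j) x → x ∈ Ω j)
    (h33 : InAk L k η α₀ Ω U₀) (h34 : InAk L k η α₀ Ω (mulCfg U' U₀)) (hAx : InAx L k Λs U₀ (mulCfg U' U₀))
    (h35 : ∀ j, j ≤ k → ∀ (z : Site d) (μ : Fin d), BondTouches (Λs j) z μ →
      (∀ x, InBox (loK L j z) (bondHiK L j z μ) x → x ∈ Ω j) →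
      ‖(avgIter L (mulCfg U' U₀) j z μ : 𝔸) - (avgIter L U₀ j z μ : 𝔸)‖ ≤ α₁)
    {ℓ : ℕ} {w : Site d} {ν : Fin d}
    {j : ℕ} (hℓj : ℓ ≤ j) (hj : j ≤ k) {y : Site d} (hy : y ∈ Λs j) (hw : Under L (j - ℓ) y w)
    {j' : ℕ} (hℓj' : ℓ ≤ j') (hj' : j' ≤ k) {y' : Site d} (hy' : y' ∈ Λs j') (hw' : Under L (j' - ℓ) y' (w + e ν)) :
    ‖(avgIter L (mulCfg U' U₀) ℓ w ν : 𝔸) - (avgIter L U₀ ℓ w ν : 𝔸)‖ ≤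
        8 * (d : ℝ) ^ 2 * α₀ * (∑ i ∈ Finset.range (min j j' - ℓ), (((L : ℝ) ^ i)⁻¹) ^ 2) + α₁ ∧
      8 * (d : ℝ) ^ 2 * α₀ * (∑ i ∈ Finset.range (min j j' - ℓ), (((L : ℝ) ^ i)⁻¹) ^ 2) + α₁ <
        11 * (d : ℝ) ^ 2 * α₀ + α₁ := by
  have hL1 : 1 ≤ L := le_trans (by norm_num) hL
  have hG : AvgClosed d L (unitaryUnits 𝔸) := avgClosed_unitaryUnits d L
  set U : Site d → Fin d → 𝔸ˣ := mulCfg U' U₀ with hU_def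
  have hU : ∀ x κ, U x κ ∈ unitaryUnits 𝔸 := fun x κ => (unitaryUnits 𝔸).mul_mem (hU' x κ) (hU₀ x κ)
  -- antitonicity of `Ω` between arbitrary levels
  have hΩle : ∀ {a b : ℕ}, a ≤ b → Ω b ⊆ Ω a := by
    intro a b hab
    induction hab with
    | refl => exact le_rfl
    | step _ ih => exact (hΩ _).trans ih
  -- the common tower level `m = min j j'` and the level-`m` ancestors of the two blocks
  set m : ℕ := min j j' with hm_def
  have hmj : m ≤ j := min_le_left _ _
  have hmj' : m ≤ j' := min_le_right _ _
  have hℓm : ℓ ≤ m := le_min hℓj hℓj'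
  have hmk : m ≤ k := hmj.trans hj
  set z : Site d := flm L (m - ℓ) w with hz_def
  set z' : Site d := flm L (m - ℓ) (w + e ν) with hz'_def
  have hzw : Under L (m - ℓ) z w := under_flm hL1 (m - ℓ) w
  have hzw' : Under L (m - ℓ) z' (w + e ν) := under_flm hL1 (m - ℓ) (w + e ν)
  have hzz' : z' = z ∨ z' = z + e ν := flm_succ_coord hL1 (m - ℓ) w ν
  have hzy : Under L (j - m) y z := by
    have h := flm_under_of_under hL1 (show m - ℓ ≤ j - ℓ by omega) hw
    rwa [show j - ℓ - (m - ℓ) = j - m by omega] at h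
  have hzy' : Under L (j' - m) y' z' := by
    have h := flm_under_of_under hL1 (show m - ℓ ≤ j' - ℓ by omega) hw'
    rwa [show j' - ℓ - (m - ℓ) = j' - m by omega] at h
  -- every site under `z` (resp. `z'`) at depth `m` lies in the tower of `y` (resp. `y'`), hence in `Ω_m`
  have hΩz : ∀ v, Under L m z v → v ∈ Ω m := by
    intro v hv
    have h1 : Under L (j - m + m) y v := under_add_of_under hzy hv
    rw [Nat.sub_add_cancel hmj] at h1
    have h1' := (under_iff_tower L j y v).1 h1
    exact hΩle hmj (htower j hj y hy v fun i => ⟨h1'.1 i, h1'.2 i⟩)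
  have hΩz' : ∀ v, Under L m z' v → v ∈ Ω m := by
    intro v hv
    have h1 : Under L (j' - m + m) y' v := under_add_of_under hzy' hv
    rw [Nat.sub_add_cancel hmj'] at h1
    have h1' := (under_iff_tower L j' y' v).1 h1
    exact hΩle hmj' (htower j' hj' y' hy' v fun i => ⟨h1'.1 i, h1'.2 i⟩)
  have hboxΩ : ∀ v, InBox (tlo L z m) (thi L z' m) v → v ∈ Ω m := by
    intro v hv
    rcases under_or_of_box_pair m hzz' (fun i => (hv i).1) (fun i => (hv i).2) with h | h
    · exact hΩz v h
    · exact hΩz' v h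
  have hlohi : z ≤ z' := by
    rcases hzz' with h | h
    · rw [h]
    · rw [h]; exact le_add_of_nonneg_right (e_nonneg ν)
  -- (1.7) inputs on the box
  have h33' : pdevOn (tlo L z m) (thi L z' m) U₀ < α₀ * (((L : ℝ) ^ m)⁻¹) ^ 2 := pdevOn_box_lt_of_inAk hL1 hα₀ h33 hmk hboxΩ
  have h34' : pdevOn (tlo L z m) (thi L z' m) U < α₀ * (((L : ℝ) ^ m)⁻¹) ^ 2 := pdevOn_box_lt_of_inAk hL1 hα₀ h34 hmk hboxΩ
  -- (1.19) inputs on the box, from `Ax_k(𝔅_k, U₀)` along the two towers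
  have hAx' := (inAx_iff L k Λs U₀ U).1 hAx
  have h19 : ∀ n, n < m → ∀ v, tlo L z n ≤ v → v ≤ thi L z' n → ∀ r : Fin d → Fin L,
      axialFn (avgIter L U (m - (n + 1))) ((L : ℤ) • v) ((L : ℤ) • v + boxVec L r) =
        axialFn (avgIter L U₀ (m - (n + 1))) ((L : ℤ) • v) ((L : ℤ) • v + boxVec L r) := by
    intro n hn v hlo hhi r
    rcases under_or_of_box_pair n hzz' hlo hhi with hv | hv
    · -- under `z`, hence under `y` at depth `j - m + n`
      have h1 : Under L (j - m + n) y v := under_add_of_under hzy hv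
      have hj1 : 1 ≤ j := by omega
      have hdepth : j - (m - (n + 1) + 1) = j - m + n := by omega
      exact hAx' j hj1 hj y hy (m - (n + 1)) (by omega) v (by rw [hdepth]; exact h1) r
    · have h1 : Under L (j' - m + n) y' v := under_add_of_under hzy' hv
      have hj1 : 1 ≤ j' := by omega
      have hdepth : j' - (m - (n + 1) + 1) = j' - m + n := by omega
      exact hAx' j' hj1 hj' y' hy' (m - (n + 1)) (by omega) v (by rw [hdepth]; exact h1) r
  -- (1.35) input: the one crossing bond of the box (if any) — it TOUCHES `Λ_m`
  have h35' : ∀ (v : Site d) (μ : Fin d), z ≤ v → v + e μ ≤ z' →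
      ‖((avgIter L U m v μ : 𝔸ˣ) : 𝔸) - avgIter L U₀ m v μ‖ ≤ α₁ := by
    intro v μ hzv hvz'
    -- then `μ = ν`, `z' = z + e ν` and `v = z`
    have hνμ : z' = z + e ν ∧ μ = ν := by
      rcases hzz' with h | h
      · exfalso
        have h1 := hvz' μ
        have h2 := hzv μ
        rw [h] at h1
        simp [e_apply] at h1
        linarith
      · refine ⟨h, ?_⟩
        by_contra hne
        have h1 := hvz' μ
        have h2 := hzv μ
        rw [h] at h1
        simp [e_apply, hne] at h1
        linarith
    obtain ⟨hz'eq, hμν⟩ := hνμ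
    subst hμν
    have hvz : v = z := by
      funext i
      have h1 := hvz' i
      have h2 := hzv i
      rw [hz'eq] at h1
      simp only [Pi.add_apply] at h1
      linarith
    rw [hvz]
    -- the crossing bond touches `Λ_m`: its lower end is `y` (`j = m`) or its upper end is `y'` (`j' = m`)
    have htouch : BondTouches (Λs m) z μ := by
      rcases Nat.le_total j j' with hjj | hjj
      · have hmj0 : m = j := by rw [hm_def]; exact min_eq_left hjj
        left
        have h0 : Under L 0 y z := by
          have h := hzy
          rwa [hmj0, Nat.sub_self] at h
        rw [(under_zero_iff L y z).1 h0, hmj0]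
        exact hy
      · have hmj0 : m = j' := by rw [hm_def]; exact min_eq_right hjj
        right
        have h0 : Under L 0 y' z' := by
          have h := hzy'
          rwa [hmj0, Nat.sub_self] at h
        rw [← hz'eq, (under_zero_iff L y' z').1 h0, hmj0]
        exact hy'
    refine h35 m hmk z μ htouch fun v hv => hboxΩ v fun i => ?_
    have h1 := hv i
    simp only [loK, bondHiK] at h1
    rw [tlo_apply, thi_apply, hz'eq, Pi.add_apply, e_apply]
    by_cases hi : i = μ
    · rw [if_pos hi] at h1; rw [if_pos hi]; constructor <;> linarith [h1.1, h1.2]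
    · rw [if_neg hi] at h1; rw [if_neg hi]; constructor <;> linarith [h1.1, h1.2]
  -- (1.65) on the box at depth `m - ℓ` below `z, z'` (lit-balaban p26), i.e. at level `ℓ`
  have hwlo : tlo L z (m - ℓ) ≤ w := ((under_iff_tower L (m - ℓ) z w).1 hzw).1
  have hwhi : w + e ν ≤ thi L z' (m - ℓ) := ((under_iff_tower L (m - ℓ) z' (w + e ν)).1 hzw').2
  have h := B8Ineq165Local.ineq165_local L hL hd hG m U₀ U hU₀ hU hα₀ hα3 hα2 z z' hlohi h33' h34' h19 h35' hα₁ hsmall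
    (m - ℓ) (Nat.sub_le m ℓ) w ν hwlo hwhi
  rwa [show m - (m - ℓ) = ℓ by omega] at h

/-- **(1.65) AT LEVEL `ℓ` FROM (1.33)–(1.35) ON THE LAYERS**, `11d²α₀ + α₁` form: under the hypotheses of `norm_avg_sub_le_of135_sharp`,
`‖(U′U₀)‾ˡ(c) − Ū₀ˡ(c)‖ ≤ 11d²α₀ + α₁` at every level-`ℓ` bond `c = ⟨w, w + e_ν⟩` whose two blocks sit in towers.
[cite: Balaban1985RegularSpaces, (1.65)–(1.66) p.87, (1.33)–(1.35) p.82] -/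
theorem norm_avg_sub_le_of135 (hd : 1 ≤ d) {L : ℕ} (hL : 2 ≤ L) (k : ℕ) {η : ℝ}
    {U₀ U' : Site d → Fin d → 𝔸ˣ} (hU₀ : ∀ x κ, U₀ x κ ∈ unitaryUnits 𝔸) (hU' : ∀ x κ, U' x κ ∈ unitaryUnits 𝔸)
    {α₀ α₁ : ℝ} (hα₀ : 0 < α₀) (hα3 : C0 d * α₀ ≤ 1 / 3) (hα2 : 2 * α₀ ≤ c2' d L) (hα₁ : 0 ≤ α₁)
    (hsmall : 11 * (d : ℝ) ^ 2 * α₀ + α₁ ≤ 1 / 6)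
    (Ω : ℕ → Set (Site d)) (hΩ : ∀ j, Ω (j + 1) ⊆ Ω j) (Λs : ℕ → Set (Site d))
    (htower : ∀ j, j ≤ k → ∀ y ∈ Λs j, ∀ x, InBox (tlo L y j) (thi L y j) x → x ∈ Ω j)
    (h33 : InAk L k η α₀ Ω U₀) (h34 : InAk L k η α₀ Ω (mulCfg U' U₀)) (hAx : InAx L k Λs U₀ (mulCfg U' U₀))
    (h35 : ∀ j, j ≤ k → ∀ (z : Site d) (μ : Fin d), BondTouches (Λs j) z μ →
      (∀ x, InBox (loK L j z) (bondHiK L j z μ) x → x ∈ Ω j) →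
      ‖(avgIter L (mulCfg U' U₀) j z μ : 𝔸) - (avgIter L U₀ j z μ : 𝔸)‖ ≤ α₁)
    {ℓ : ℕ} {w : Site d} {ν : Fin d}
    {j : ℕ} (hℓj : ℓ ≤ j) (hj : j ≤ k) {y : Site d} (hy : y ∈ Λs j) (hw : Under L (j - ℓ) y w)
    {j' : ℕ} (hℓj' : ℓ ≤ j') (hj' : j' ≤ k) {y' : Site d} (hy' : y' ∈ Λs j') (hw' : Under L (j' - ℓ) y' (w + e ν)) :
    ‖(avgIter L (mulCfg U' U₀) ℓ w ν : 𝔸) - (avgIter L U₀ ℓ w ν : 𝔸)‖ ≤ 11 * (d : ℝ) ^ 2 * α₀ + α₁ := by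
  have h := norm_avg_sub_le_of135_sharp hd hL k hU₀ hU' hα₀ hα3 hα2 hα₁ hsmall Ω hΩ Λs htower h33 h34 hAx h35
    hℓj hj hy hw hℓj' hj' hy' hw'
  exact h.1.trans h.2.le

/-! ## §3 (1.33)–(1.35) ⇒ (1.66) AT EVERY LEVEL, for a region sequence carrying the tower decomposition (1.6) at every level -/

/-- **(1.65) ⇒ (1.66) AT EVERY LEVEL** (p. 87 «Thus the conditions (1.33)–(1.35) imply |Ũ′ʲ − 1| < 11d²α₀ + α₁ on Ω_j^{(j)}», all
`j = 0, …, k`): under (1.33), (1.34) (`InAk` ×2 + `InAx`), **(1.35) on the layers** (touching form, boxes in `Ω_j`), towers `Bʲ(y) ⊂ Ω_j`,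
`Ω` antitone, the windows of (1.65), AND the tower decomposition (1.6) AT EVERY LEVEL — `h16`: every level-`ℓ` block `Bˡ(w) ⊂ Ω_ℓ`
(`ℓ ≤ k`) lies in a tower, `Bˡ(w) ⊂ Bʲ(y)` for some `y ∈ Λ_j`, `ℓ ≤ j ≤ k` (print: `Ω_ℓ^{(ℓ)} = Λ_ℓ ∪ B(Ω_{ℓ+1}^{(ℓ+1)})`) — the tree's
(1.66) currency holds with `α₁ ↦ 11d²α₀ + α₁`: for every `ℓ ≤ k` and every level-`ℓ` bond `⟨w, w + e_ν⟩` whose two-block box lies in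
`Ω_ℓ`, `‖(U′U₀)‾ˡ − Ū₀ˡ‖ ≤ 11d²α₀ + α₁`. [cite: Balaban1985RegularSpaces, (1.65)–(1.66) p.87, (1.3)–(1.6) p.77, (1.33)–(1.35) p.82] -/
theorem norm_avg_sub_le_allLevels_of135 (hd : 1 ≤ d) {L : ℕ} (hL : 2 ≤ L) (k : ℕ) {η : ℝ}
    {U₀ U' : Site d → Fin d → 𝔸ˣ} (hU₀ : ∀ x κ, U₀ x κ ∈ unitaryUnits 𝔸) (hU' : ∀ x κ, U' x κ ∈ unitaryUnits 𝔸)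
    {α₀ α₁ : ℝ} (hα₀ : 0 < α₀) (hα3 : C0 d * α₀ ≤ 1 / 3) (hα2 : 2 * α₀ ≤ c2' d L) (hα₁ : 0 ≤ α₁)
    (hsmall : 11 * (d : ℝ) ^ 2 * α₀ + α₁ ≤ 1 / 6)
    (Ω : ℕ → Set (Site d)) (hΩ : ∀ j, Ω (j + 1) ⊆ Ω j) (Λs : ℕ → Set (Site d))
    (htower : ∀ j, j ≤ k → ∀ y ∈ Λs j, ∀ x, InBox (tlo L y j) (thi L y j) x → x ∈ Ω j)
    (h16 : ∀ ℓ, ℓ ≤ k → ∀ w : Site d, (∀ x, InBox (tlo L w ℓ) (thi L w ℓ) x → x ∈ Ω ℓ) →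
      ∃ j, ℓ ≤ j ∧ j ≤ k ∧ ∃ y ∈ Λs j, Under L (j - ℓ) y w)
    (h33 : InAk L k η α₀ Ω U₀) (h34 : InAk L k η α₀ Ω (mulCfg U' U₀)) (hAx : InAx L k Λs U₀ (mulCfg U' U₀))
    (h35 : ∀ j, j ≤ k → ∀ (z : Site d) (μ : Fin d), BondTouches (Λs j) z μ →
      (∀ x, InBox (loK L j z) (bondHiK L j z μ) x → x ∈ Ω j) →
      ‖(avgIter L (mulCfg U' U₀) j z μ : 𝔸) - (avgIter L U₀ j z μ : 𝔸)‖ ≤ α₁)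
    {ℓ : ℕ} (hℓ : ℓ ≤ k) (w : Site d) (ν : Fin d) (hbox : ∀ x, InBox (loK L ℓ w) (bondHiK L ℓ w ν) x → x ∈ Ω ℓ) :
    ‖(avgIter L (mulCfg U' U₀) ℓ w ν : 𝔸) - (avgIter L U₀ ℓ w ν : 𝔸)‖ ≤ 11 * (d : ℝ) ^ 2 * α₀ + α₁ := by
  obtain ⟨j, hℓj, hj, y, hy, hw⟩ := h16 ℓ hℓ w fun x hx => hbox x (inBox_bondBox_of_inBox_block_fst L ℓ w ν hx)
  obtain ⟨j', hℓj', hj', y', hy', hw'⟩ :=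
    h16 ℓ hℓ (w + e ν) fun x hx => hbox x (inBox_bondBox_of_inBox_block_snd L ℓ w ν hx)
  exact norm_avg_sub_le_of135 hd hL k hU₀ hU' hα₀ hα3 hα2 hα₁ hsmall Ω hΩ Λs htower h33 h34 hAx h35
    hℓj hj hy hw hℓj' hj' hy' hw'

/-! ## §4 The level-`0` member on all bonds of `ℤᵈ`, towers covering `ℤᵈ` — the statement p433133 meant -/

/-- **(1.66)₀ ON EVERY BOND OF `ℤᵈ` FROM (1.33)–(1.35) ON THE LAYERS** (p. 87, at `j = 0`, `Ω₀ = ℤᵈ`; the REPAIRED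
`B8Ineq166Univ.norm_pert_sub_one_le_univ`, whose closeness hypothesis was the all-levels box form = (1.66) itself): under (1.33), (1.34),
**(1.35) on the layers** (touching form, boxes in `Ω_j`), towers `Bʲ(y) ⊂ Ω_j` for `y ∈ Λs j` COVERING `ℤᵈ` (`hpart`, (1.6) at level `0`),
`Ω` antitone and the windows of (1.65): `‖U′_b − 1‖ ≤ 11d²α₀ + α₁` at EVERY bond `b = ⟨x, x + e_μ⟩` of `ℤᵈ`.
[cite: Balaban1985RegularSpaces, (1.65)–(1.66) p.87, (1.33)–(1.35) p.82, (1.6) p.77, (1.20) p.79] -/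
theorem norm_pert_sub_one_le_univ_of135 (hd : 1 ≤ d) {L : ℕ} (hL : 2 ≤ L) (k : ℕ) {η : ℝ}
    {U₀ U' : Site d → Fin d → 𝔸ˣ} (hU₀ : ∀ x κ, U₀ x κ ∈ unitaryUnits 𝔸) (hU' : ∀ x κ, U' x κ ∈ unitaryUnits 𝔸)
    {α₀ α₁ : ℝ} (hα₀ : 0 < α₀) (hα3 : C0 d * α₀ ≤ 1 / 3) (hα2 : 2 * α₀ ≤ c2' d L) (hα₁ : 0 ≤ α₁)
    (hsmall : 11 * (d : ℝ) ^ 2 * α₀ + α₁ ≤ 1 / 6)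
    (Ω : ℕ → Set (Site d)) (hΩ : ∀ j, Ω (j + 1) ⊆ Ω j) (Λs : ℕ → Set (Site d))
    (htower : ∀ j, j ≤ k → ∀ y ∈ Λs j, ∀ x, InBox (tlo L y j) (thi L y j) x → x ∈ Ω j)
    (hpart : ∀ x : Site d, ∃ j, j ≤ k ∧ ∃ y ∈ Λs j, InBox (tlo L y j) (thi L y j) x)
    (h33 : InAk L k η α₀ Ω U₀) (h34 : InAk L k η α₀ Ω (mulCfg U' U₀)) (hAx : InAx L k Λs U₀ (mulCfg U' U₀))
    (h35 : ∀ j, j ≤ k → ∀ (z : Site d) (μ : Fin d), BondTouches (Λs j) z μ →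
      (∀ x, InBox (loK L j z) (bondHiK L j z μ) x → x ∈ Ω j) →
      ‖(avgIter L (mulCfg U' U₀) j z μ : 𝔸) - (avgIter L U₀ j z μ : 𝔸)‖ ≤ α₁)
    (x : Site d) (μ : Fin d) : ‖((U' x μ : 𝔸ˣ) : 𝔸) - 1‖ ≤ 11 * (d : ℝ) ^ 2 * α₀ + α₁ := by
  obtain ⟨j, hj, y, hy, hx⟩ := hpart x
  obtain ⟨j', hj', y', hy', hx'⟩ := hpart (x + e μ)
  have hxu : Under L (j - 0) y x := (under_iff_tower L j y x).2 ⟨fun i => (hx i).1, fun i => (hx i).2⟩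
  have hxu' : Under L (j' - 0) y' (x + e μ) := (under_iff_tower L j' y' (x + e μ)).2 ⟨fun i => (hx' i).1, fun i => (hx' i).2⟩
  have h := norm_avg_sub_le_of135 hd hL k hU₀ hU' hα₀ hα3 hα2 hα₁ hsmall Ω hΩ Λs htower h33 h34 hAx h35
    (Nat.zero_le j) hj hy hxu (Nat.zero_le j') hj' hy' hxu'
  rw [avgIter_zero, avgIter_zero] at h
  have hV₀ : U₀ x μ ∈ U1 𝔸 := unitaryUnits_le_U1 (hU₀ x μ)
  have hc := norm_pert_le_norm_sub (p := mulCfg U' U₀ x μ) hV₀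
  have hpert : mulCfg U' U₀ x μ * (U₀ x μ)⁻¹ = U' x μ := by simp [mulCfg]
  rw [hpert] at hc
  exact hc.trans h

end Towers

#print axioms norm_avg_sub_le_of135_sharp
#print axioms norm_avg_sub_le_allLevels_of135
#print axioms norm_pert_sub_one_le_univ_of135

end Literature.MathematicalPhysics.QuantumFieldTheory.Balaban1983to89.B8Ineq165AllLevels

end
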